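import Summits.Langlands.Langlands.Theses.ParityBlindBianchi
import Literature.NumberTheory.GaloisRepresentations.PolarizedDeformationRing
import Summits.Langlands.Langlands.Theorems.ParityBlindBianchiTwoAdicBianchiProModularityLevelSqueezeDefs
import HarnessLib

/-!
# Line `dimension-squeeze` (crux `TwoAdicBianchiProModularityLevel`, stmt-Langlands-15110): AUT, first lemma

The registered sub-goal `squeeze_heckeDimension_of_denseQuotient` — the formal first lemma of the
automorphic stub `stub_heckeDimension` (AUT) of the checked skeleton
`Cruxes/TwoAdicBianchiProModularityLevel/Lines/dimension_squeeze.lean`: AUT ("the Zariski closure of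
the type-`θ` Hecke points of level `U` in `Spec R` has Krull dimension `≥ 4`") follows from the
existence of a surjection `q : R ↠ T` onto a ring of Krull dimension `≥ 4` whose `𝒪_{ℚ̄₂}`-points
that are Hecke points of `R` separate the elements of `T`.  Intended `T`: the reduced big Hecke algebra
`𝕋^θ(U²)_{𝔪,red}` of the `2`-power Bianchi tower; the three remaining inputs are SURJ (`R ↠ 𝕋_𝔪`:
Scholze's determinant + Chenevier + Carayol), DENSITY (the `𝒪_{ℚ̄₂}`-points of a `2`-torsion-free
complete Noetherian local `𝒪`-algebra with finite residue field are Zariski-dense — pure algebra) and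
DIM (`dim 𝕋^θ_𝔪 ≥ 1 + dim B − l₀ = 4` with `𝕋^θ_𝔪` `2`-torsion-free: Gee–Newton Prop. 54 + (c) +
(c)-lite + App. §6.3 — the open part, GeeNewton2020 Rem. 55(3)/58).  Pure algebra; vocabulary from the
landed Defs file `ParityBlindBianchiTwoAdicBianchiProModularityLevelSqueezeDefs.lean` (p137908).

Reference: T. Gee, J. Newton, *Patching and the completed homology of locally symmetric spaces*,
JIMJ (2022) / arXiv:1609.06965, Prop. 54, Rem. 55, Prop. 57, Rem. 58. [cite: GeeNewton2020, Prop. 54 and Rem. 58]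
-/

noncomputable section

set_option linter.dupNamespace false -- `Summit.Langlands.Langlands` is the mandated namespace (D-0017)

open scoped NumberField MatrixGroups
open Polynomial IsDedekindDomain Field
open Literature.NumberTheory.GaloisRepresentations Literature.NumberTheory.Automorphic

namespace Summit.Langlands.Langlands.Cruxes.TwoAdicBianchiProModularityLevel.DimensionSqueeze

/-! ### AUT, first lemma: reduction to a dense Hecke quotient -/

/-- REGISTERED SUB-GOAL `squeeze_heckeDimension_of_denseQuotient` (lead c14; the formal first lemma of
AUT = `stub_heckeDimension`).  **AUT follows from a Hecke quotient of `R` with Zariski-dense Hecke points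
and Krull dimension `≥ 4`.**  If `q : R ↠ T` is a surjection such that every `𝒪_{ℚ̄₂}`-point `ψ` of `T`
with `ψ ∘ q` a type-`θ` Hecke point of level `U`, taken together, separate the elements of `T`
(`(∀ such ψ, ψ (q x) = 0) → q x = 0`: the Hecke points factoring through `T` are Zariski-dense in
`Spec T`), then `J_U ≤ ker q`, so `R ⧸ J_U ↠ T` and `dim (R ⧸ J_U) ≥ dim T ≥ 4`.  Intended `T`: the
reduced, `2`-torsion-free big Hecke algebra `𝕋^θ(U²)_{𝔪,red}` of the `2`-power Bianchi tower (SURJ by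
Scholze–Chenevier–Carayol, DENSITY of `𝒪_{ℚ̄₂}`-points in a `2`-torsion-free complete Noetherian local
`𝒪`-algebra with finite residue field, TYPE by torsion local–global compatibility at the odd places,
`dim ≥ 4` = Gee–Newton (c) + (c)-lite + App. §6 — the open part).
[cite: GeeNewton2020, Prop. 54 and Rem. 58] -/
theorem squeeze_heckeDimension_of_denseQuotient : ∀ (K : Type) [Field K] [NumberField K]
    (σ : FramedGaloisRep K (PadicAlgCl 2) 2) (M : Model σ) (S₀ : Finset ℕ) (h0 : (0 : ℕ) ∉ S₀) (h2 : 2 ∈ S₀)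
    (hunr : ∀ v ∉ badSet K S₀, Deformation.IsUnramifiedAt v M.residual)
    (𝓡 : PolarizedDeformationRing (M.datum S₀ h0 h2 hunr))
    (U : Subgroup (GL (Fin 2) (FiniteAdeleRing (𝓞 K) K)))
    (ϖ : ∀ v : HeightOneSpectrum (𝓞 K), (v.adicCompletion K)ˣ)
    (T : Type) [CommRing T] (q : 𝓡.R →+* T), Function.Surjective q →
    (∀ x : 𝓡.R, (∀ ψ : T →+* O2, ψ.comp q ∈ M.heckePoints 𝓡 U ϖ → ψ (q x) = 0) → q x = 0) →
    (4 : WithBot ℕ∞) ≤ ringKrullDim T →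
    (4 : WithBot ℕ∞) ≤ ringKrullDim (𝓡.R ⧸ M.heckeIdeal 𝓡 U ϖ) := by
  intro K _ _ σ M S₀ h0 h2 hunr 𝓡 U ϖ T _ q hq hdense hdim
  -- `J_U ≤ ker q`
  have hle : M.heckeIdeal 𝓡 U ϖ ≤ RingHom.ker q := by
    intro x hx
    rw [RingHom.mem_ker]
    refine hdense x fun ψ hψ => ?_
    have hx' : x ∈ RingHom.ker (ψ.comp q) := by
      have := (Submodule.mem_iInf _).mp hx (ψ.comp q)
      exact (Submodule.mem_iInf _).mp this hψ
    simpa [RingHom.mem_ker] using hx'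
  -- `R ⧸ J_U ↠ R ⧸ ker q ≅ T`
  have hsurj : Function.Surjective ((RingHom.quotientKerEquivOfSurjective hq).toRingHom.comp
      (Ideal.Quotient.factor hle)) :=
    (RingHom.quotientKerEquivOfSurjective hq).surjective.comp (Ideal.Quotient.factor_surjective hle)
  exact hdim.trans (ringKrullDim_le_of_surjective _ hsurj)

end Summit.Langlands.Langlands.Cruxes.TwoAdicBianchiProModularityLevel.DimensionSqueeze

end
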